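import Literature.AlgebraicGeometry.Resolution.StrictTransformFiniteFinitePresentation
import Literature.AlgebraicGeometry.Resolution.StrictTransformBaseLocality
import Literature.AlgebraicGeometry.Morphisms.FittingIdealSheaf
import HarnessLib

/-!
# Raynaud–Gruson flattening of finite morphisms of constant rank over an arbitrary base
(a case of Stacks 081R / 0811)

Topic: `Literature/AlgebraicGeometry/Resolution`. Globalisation of
`StrictTransformFiniteFinitePresentation.lean` (finite morphisms over an AFFINE base) to an
arbitrary base scheme `S`, with the centre expressed by the Fitting ideal sheaves of `f_*𝒪_X`
(`Scheme.Hom.fittingIdealSheaf`, `FittingIdealSheaf.lean`): let `f : X → S` be FINITE and let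
`𝓚 ⊆ 𝒪_S` be an ideal sheaf of finite type with `𝓚ᵐ ⊆ Fit_r(f_*𝒪_X)` and
`𝓚ⁿ · Fit_k(f_*𝒪_X) = 0` for `k < r` — i.e. `X` is finite locally free of rank `r` over
`U = S ∖ V(𝓚)` — with `Fit_r(f_*𝒪_X)` of finite type. Then the blowing up `b : S' → S` of `S` in
the finite type centre `𝓚 · Fit_r(f_*𝒪_X)`, supported on `V(𝓚) = S ∖ U` (a `U`-admissible
blowing up), makes the strict transform of `X` flat and locally of finite presentation over `S'`
— the special case "`f` finite, `X` finite locally free of constant rank `r` over `U`,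
`Fit_r(f_*𝒪_X)` of finite type" of the named fact `Stacks081R` (Raynaud–Gruson 1971, Thm. 5.2.2;
Stacks 0811), with an explicit centre; no quasi-compactness or quasi-separatedness of `S` is
needed (a feature of the explicit centre).

Proof: "we may assume `S` affine" — flatness and local finite presentation of the strict
transform are local on the base (`blowupStrictTransformMap_of_openCover_base`,
`StrictTransformBaseLocality.lean`); over an affine open `T ⊆ S` everything is the situation of
`StrictTransformFiniteFlatAdmissible.lean` for `X ×_S T → T`, the Fitting ideal sheaf restricting
to the Fitting ideal of `Γ(X ×_S T)` over `Γ(T)` (`fittingIdealSheaf_comap_ideal_top`, transport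
of Fitting ideals along the isomorphism `Γ(X, f⁻¹T) ≅ Γ(X ×_S T)`).

* `fittingIdealSheaf_comap_ideal_top` — `Fit_k(f_*𝒪_X)|_T (T) = Fit_k(Γ(X ×_S T))` for an
  affine `T → S` open immersion;
* `flat_and_lfp_blowupStrictTransformMap_chart` — the chart statement;
* `exists_isBlowup_flat_lfp_blowupStrictTransformMap_of_isFinite_of_fittingIdealSheaf` —
  **Stacks 081R for finite morphisms of constant rank `r` over `U`, over an arbitrary base.**

## References

* M. Raynaud, L. Gruson, *Critères de platitude et de projectivité*, Invent. Math. 13 (1971),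
  Première partie, Thm. 5.2.2. [RaynaudGruson1971]
* The Stacks Project, Tag 081R (Lemma 38.31.1), Tag 0811, Tag 0C3C. [StacksProject]
-/

noncomputable section

open CategoryTheory CategoryTheory.Limits AlgebraicGeometry TopologicalSpace

namespace Literature.AlgebraicGeometry.Resolution

universe u

open Literature.RingTheory.FittingIdeal Literature.AlgebraicGeometry.Limits
  Literature.AlgebraicGeometry.Morphisms

/-! ## Restriction of the Fitting ideal sheaf to an affine chart of the base -/

section Chart

variable {X S T : Scheme.{u}} (f : X ⟶ S) (ι : T ⟶ S) [IsOpenImmersion ι]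

/-- The image of `X ×_S T → X` is `f⁻¹(ι(T))`. [folklore] -/
theorem image_top_pullback_fst_eq : (pullback.fst f ι) ''ᵁ ⊤ = f ⁻¹ᵁ (ι ''ᵁ ⊤) := by
  apply Opens.ext
  rw [Scheme.Hom.image_top_eq_opensRange, Scheme.Hom.coe_opensRange, Scheme.Pullback.range_fst]
  show _ = f ⁻¹' ((ι ''ᵁ ⊤ : S.Opens) : Set S)
  rw [Scheme.Hom.image_top_eq_opensRange, Scheme.Hom.coe_opensRange]

/-- The comparison `Γ(X, f⁻¹(ι(T))) ⟶ Γ(X ×_S T)`, an isomorphism. [folklore] -/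
def sectionsChartHom : Γ(X, f ⁻¹ᵁ (ι ''ᵁ ⊤)) ⟶ Γ(pullback f ι, ⊤) :=
  X.presheaf.map (eqToHom (image_top_pullback_fst_eq f ι)).op ≫ ((pullback.fst f ι).appIso ⊤).hom

/-- `sectionsChartHom` is an isomorphism. [folklore] -/
instance isIso_sectionsChartHom : IsIso (sectionsChartHom f ι) := by
  unfold sectionsChartHom
  rw [eqToHom_op, eqToHom_map]
  infer_instance

/-- Compatibility of `sectionsChartHom` with the structure maps: `Γ(S, ι(T)) → Γ(X, f⁻¹ι(T)) ≅ Γ(X ×_S T)`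
equals `Γ(S, ι(T)) ≅ Γ(T) → Γ(X ×_S T)`. [folklore] -/
theorem app_sectionsChartHom :
    f.app (ι ''ᵁ ⊤) ≫ sectionsChartHom f ι = (ι.appIso ⊤).hom ≫ (pullback.snd f ι).appTop := by
  rw [sectionsChartHom, Scheme.Hom.appIso_hom', Scheme.Hom.appIso_hom', Scheme.Hom.app_eq_appLE,
    ← Category.assoc, Scheme.Hom.appLE_map, Scheme.Hom.appLE_comp_appLE, Scheme.Hom.appTop,
    Scheme.Hom.app_eq_appLE]
  erw [Scheme.Hom.appLE_comp_appLE]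
  exact appLE_congr_hom pullback.condition _ _ _

/-- **The Fitting ideal sheaf restricts to the Fitting ideal of the chart**: for a finite `f`,
an open immersion `ι : T → S` from an affine `T`, and every `k`, the ideal of global sections of
`Fit_k(f_*𝒪_X)|_T` is the `k`-th Fitting ideal over `Γ(T)` of `Γ(X ×_S T)` (the sections module
of the finite `X ×_S T → T`). [cite: StacksProject, Tag 0C3C] -/
theorem fittingIdealSheaf_comap_ideal_top [IsFinite f] [IsAffine T] (k : ℕ) :
    ((f.fittingIdealSheaf k).comap ι).ideal ⟨⊤, isAffineOpen_top T⟩ =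
      (letI := (pullback.snd f ι).appTop.hom.toAlgebra;
        Module.fittingIdeal Γ(T, ⊤) Γ(pullback f ι, ⊤) k) := by
  letI algW : Algebra Γ(S, ι ''ᵁ ⊤) Γ(X, f ⁻¹ᵁ (ι ''ᵁ ⊤)) := (f.app (ι ''ᵁ ⊤)).hom.toAlgebra
  letI algT : Algebra Γ(T, ⊤) Γ(pullback f ι, ⊤) := ((pullback.snd f ι).appTop).hom.toAlgebra
  rw [Scheme.IdealSheafData.ideal_comap_of_isOpenImmersion, fittingIdealSheaf_ideal]
  -- comap along the inverse of the isomorphism `Γ(S, ι(T)) ≅ Γ(T)` is map along it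
  let ε : Γ(S, ι ''ᵁ ⊤) ≃+* Γ(T, ⊤) := (ι.appIso ⊤).commRingCatIsoToRingEquiv
  have hcomap : ∀ J : Ideal Γ(S, ι ''ᵁ ⊤), J.comap (ι.appIso ⊤).inv.hom = J.map (ε : _ →+* _) :=
    fun J => Ideal.comap_symm ε
  rw [hcomap]
  -- transport along `Γ(X, f⁻¹ι(T)) ≅ Γ(X ×_S T)`
  let e : Γ(X, f ⁻¹ᵁ (ι ''ᵁ ⊤)) ≃+* Γ(pullback f ι, ⊤) :=
    (asIso (sectionsChartHom f ι)).commRingCatIsoToRingEquiv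
  refine fittingIdeal_map_ringEquiv ε e.toAddEquiv (fun s m => ?_) k
  change e (f.app (ι ''ᵁ ⊤) s * m) = (pullback.snd f ι).appTop (ε s) * e m
  rw [map_mul]
  congr 1
  change (f.app (ι ''ᵁ ⊤) ≫ sectionsChartHom f ι) s = ((ι.appIso ⊤).hom ≫ (pullback.snd f ι).appTop) s
  rw [app_sectionsChartHom]

end Chart

/-! ## The chart statement and the global theorem -/

section Main

variable {X S : Scheme.{u}} (f : X ⟶ S) [IsFinite f]

/-- On an affine scheme, an ideal sheaf is the ideal sheaf of its global sections. [folklore] -/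
theorem eq_ofIdealTop_ideal_top {T : Scheme.{u}} [IsAffine T] (𝓙 : T.IdealSheafData) :
    𝓙 = Scheme.IdealSheafData.ofIdealTop (𝓙.ideal ⟨⊤, isAffineOpen_top T⟩) :=
  (Scheme.IdealSheafData.equivOfIsAffine (X := T)).symm_apply_apply 𝓙 |>.symm

/-- **The chart statement**: over an affine open `T ⊆ S` (an open immersion `ι : T → S` from
an affine scheme), the strict transform of `X ×_S T → T` along `S' ×_S T → T` with respect to
the restricted centre `(𝓚 · Fit_r)|_T` is flat and locally of finite presentation, for `b` a
blowing up of `S` in `𝓚 · Fit_r(f_*𝒪_X)` and `X` finite locally free of rank `r` off `V(𝓚)`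
(`𝓚ⁿ Fit_k = 0` for `k < r`). [cite: StacksProject, Tag 081R; RaynaudGruson1971, Première partie 5.2.2] -/
theorem flat_and_lfp_blowupStrictTransformMap_chart (𝓚 : S.IdealSheafData) {r : ℕ}
    (hrank : ∀ k < r, ∃ n : ℕ, 𝓚 ^ n * f.fittingIdealSheaf k = ⊥)
    {S' : Scheme.{u}} {b : S' ⟶ S} (hb : IsBlowup b (𝓚 * f.fittingIdealSheaf r))
    {T : Scheme.{u}} [IsAffine T] (ι : T ⟶ S) [IsOpenImmersion ι] :
    Flat (blowupStrictTransformMap (pullback.snd f ι) (pullback.snd b ι)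
      ((𝓚 * f.fittingIdealSheaf r).comap ι)) ∧
    LocallyOfFinitePresentation (blowupStrictTransformMap (pullback.snd f ι) (pullback.snd b ι)
      ((𝓚 * f.fittingIdealSheaf r).comap ι)) := by
  haveI : IsAffine (pullback f ι) := isAffine_of_isAffineHom (pullback.snd f ι)
  letI alg : Algebra Γ(T, ⊤) Γ(pullback f ι, ⊤) := (pullback.snd f ι).appTop.hom.toAlgebra
  -- the Fitting ideals of the chart are the restrictions of the Fitting ideal sheaves
  have hFit : ∀ k, ((f.fittingIdealSheaf k).comap ι).ideal ⟨⊤, isAffineOpen_top T⟩ =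
      Module.fittingIdeal Γ(T, ⊤) Γ(pullback f ι, ⊤) k := fun k =>
    fittingIdealSheaf_comap_ideal_top f ι k
  -- the restricted centre and Fitting sheaf as ideal sheaves of ideals of global sections
  have hC : (𝓚 * f.fittingIdealSheaf r).comap ι = Scheme.IdealSheafData.ofIdealTop
      ((𝓚.comap ι).ideal ⟨⊤, isAffineOpen_top T⟩ *
        Module.fittingIdeal Γ(T, ⊤) Γ(pullback f ι, ⊤) r) := by
    rw [eq_ofIdealTop_ideal_top ((𝓚 * f.fittingIdealSheaf r).comap ι), comap_mul,
      Scheme.IdealSheafData.ideal_mul, Pi.mul_apply, hFit]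
  have hF : (f.fittingIdealSheaf r).comap ι = Scheme.IdealSheafData.ofIdealTop
      (Module.fittingIdeal Γ(T, ⊤) Γ(pullback f ι, ⊤) r) := by
    rw [eq_ofIdealTop_ideal_top ((f.fittingIdealSheaf r).comap ι), hFit]
  -- the two divisors on `S' ×_S T`
  have hbC : IsEffectiveCartier ((Scheme.IdealSheafData.ofIdealTop
      ((𝓚.comap ι).ideal ⟨⊤, isAffineOpen_top T⟩ *
        Module.fittingIdeal Γ(T, ⊤) Γ(pullback f ι, ⊤) r)).comap (pullback.snd b ι)) := by
    rw [← hC, ← Scheme.IdealSheafData.comap_comp, ← pullback.condition,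
      Scheme.IdealSheafData.comap_comp]
    exact hb.isEffectiveCartier.comap_of_isOpenImmersion _
  have hbI : IsEffectiveCartier ((Scheme.IdealSheafData.ofIdealTop
      (Module.fittingIdeal Γ(T, ⊤) Γ(pullback f ι, ⊤) r)).comap (pullback.snd b ι)) := by
    rw [← hF, ← Scheme.IdealSheafData.comap_comp, ← pullback.condition,
      Scheme.IdealSheafData.comap_comp]
    have h := hb.isEffectiveCartier
    rw [comap_mul] at h
    exact h.of_mul_right.comap_of_isOpenImmersion _
  -- the rank hypothesis on the chart
  have hK : ∀ k < r, ∃ n : ℕ, (𝓚.comap ι).ideal ⟨⊤, isAffineOpen_top T⟩ ^ n *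
      Module.fittingIdeal Γ(T, ⊤) Γ(pullback f ι, ⊤) k = ⊥ := by
    intro k hk
    obtain ⟨n, hn⟩ := hrank k hk
    refine ⟨n, ?_⟩
    have h := congrArg (fun 𝓙 : S.IdealSheafData => (𝓙.comap ι).ideal ⟨⊤, isAffineOpen_top T⟩) hn
    simp only at h
    rwa [comap_mul, comap_pow, Scheme.IdealSheafData.comap_bot, Scheme.IdealSheafData.ideal_mul,
      Scheme.IdealSheafData.ideal_pow, Scheme.IdealSheafData.ideal_bot, Pi.mul_apply, Pi.pow_apply,
      Pi.bot_apply, hFit] at h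
  rw [hC]
  exact ⟨flat_blowupStrictTransformMap_admissible_of_isFinite_of_isAffine (pullback.snd f ι) rfl hK
      Ideal.mul_le_left Ideal.mul_le_right _ hbC hbI,
    locallyOfFinitePresentation_blowupStrictTransformMap_admissible_of_isFinite_of_isAffine
      (pullback.snd f ι) rfl hK Ideal.mul_le_left Ideal.mul_le_right _ hbC hbI⟩

/-- **Raynaud–Gruson flattening (a case of Stacks 081R): finite morphisms, locally free of
constant rank `r` over `U`, over an arbitrary base.** Let `f : X → S` be a finite morphism,
`r ≥ 0`, and `𝓚 ⊆ 𝒪_S` an ideal sheaf of finite type with `𝓚ᵐ ⊆ Fit_r(f_*𝒪_X)`,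
`Fit_r(f_*𝒪_X)` of finite type (automatic when `f` is of finite presentation), and
`𝓚ⁿ Fit_k(f_*𝒪_X) = 0` for `k < r` — i.e. `X` is finite locally free of constant rank `r` over
`U = S ∖ V(𝓚)`. Then the blowing up `b : S' → S` of `S` in the finite type ideal sheaf
`𝓚 · Fit_r(f_*𝒪_X)`, whose support lies in `V(𝓚) = S ∖ U` (a `U`-admissible blowing up), makes
the strict transform of `X` flat and locally of finite presentation over `S'`. This is the
special case "finite, constant rank, `Fit_r` of finite type" of `Stacks081R` (which as printed
has `X → S` of finite type and `X_U → U` flat and locally of finite presentation); the centre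
being explicit, no quasi-compactness or quasi-separatedness of `S` is needed.
[cite: RaynaudGruson1971, Première partie Thm. 5.2.2; StacksProject, Tag 081R, Tag 0811] -/
theorem exists_isBlowup_flat_lfp_blowupStrictTransformMap_of_isFinite_of_fittingIdealSheaf
    (𝓚 : S.IdealSheafData) {r : ℕ} (hKF : ∃ m : ℕ, 𝓚 ^ m ≤ f.fittingIdealSheaf r)
    (hrank : ∀ k < r, ∃ n : ℕ, 𝓚 ^ n * f.fittingIdealSheaf k = ⊥)
    (hKfg : ∀ W : S.affineOpens, (𝓚.ideal W).FG)
    (hFfg : ∀ W : S.affineOpens, ((f.fittingIdealSheaf r).ideal W).FG) :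
    ∃ (S' : Scheme.{u}) (b : S' ⟶ S),
      (∀ W : S.affineOpens, ((𝓚 * f.fittingIdealSheaf r).ideal W).FG) ∧
      Disjoint ((centreCompl 𝓚 : S.Opens) : Set S) ((𝓚 * f.fittingIdealSheaf r).support : Set S) ∧
      IsBlowup b (𝓚 * f.fittingIdealSheaf r) ∧
      Flat (blowupStrictTransformMap f b (𝓚 * f.fittingIdealSheaf r)) ∧
      LocallyOfFinitePresentation (blowupStrictTransformMap f b (𝓚 * f.fittingIdealSheaf r)) := by
  obtain ⟨S', b, hb⟩ := Stacks01OG_holds S (𝓚 * f.fittingIdealSheaf r)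
  refine ⟨S', b, fun W => ?_, ?_, hb, ?_, ?_⟩
  · rw [Scheme.IdealSheafData.ideal_mul, Pi.mul_apply]
    exact (hKfg W).mul (hFfg W)
  · obtain ⟨m, hm⟩ := hKF
    rw [Set.disjoint_left]
    intro x hxU hxC
    rw [Scheme.IdealSheafData.support_mul] at hxC
    apply hxU
    rcases hxC with hxK | hxF
    · exact hxK
    · have h := Scheme.IdealSheafData.support_antitone hm hxF
      rcases Nat.eq_zero_or_pos m with rfl | hpos
      · rw [pow_zero, show (1 : S.IdealSheafData) = ⊤ from rfl,
          Scheme.IdealSheafData.support_top] at h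
        exact h.elim
      · rwa [Scheme.IdealSheafData.support_pow _ _ hpos.ne'] at h
  · exact blowupStrictTransformMap_of_openCover_base f b _ @Flat hb.isEffectiveCartier S.affineCover
      fun k => (flat_and_lfp_blowupStrictTransformMap_chart f 𝓚 hrank hb (S.affineCover.f k)).1
  · exact blowupStrictTransformMap_of_openCover_base f b _ @LocallyOfFinitePresentation
      hb.isEffectiveCartier S.affineCover
      fun k => (flat_and_lfp_blowupStrictTransformMap_chart f 𝓚 hrank hb (S.affineCover.f k)).2

/-- **The same for ANY blowing up in the centre `𝓚 · Fit_r(f_*𝒪_X)`** (the blowing up being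
unique up to isomorphism, this is only formally stronger; it is the form used when the blowing
up is constructed elsewhere, e.g. as a restriction of a global one): the strict transform is
flat and locally of finite presentation. No finite type hypotheses are needed for this part.
[cite: RaynaudGruson1971, Première partie Thm. 5.2.2; StacksProject, Tag 081R, Tag 0811] -/
theorem flat_and_lfp_blowupStrictTransformMap_of_isBlowup (𝓚 : S.IdealSheafData) {r : ℕ}
    (hrank : ∀ k < r, ∃ n : ℕ, 𝓚 ^ n * f.fittingIdealSheaf k = ⊥)
    {S' : Scheme.{u}} {b : S' ⟶ S} (hb : IsBlowup b (𝓚 * f.fittingIdealSheaf r)) :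
    Flat (blowupStrictTransformMap f b (𝓚 * f.fittingIdealSheaf r)) ∧
      LocallyOfFinitePresentation (blowupStrictTransformMap f b (𝓚 * f.fittingIdealSheaf r)) :=
  ⟨blowupStrictTransformMap_of_openCover_base f b _ @Flat hb.isEffectiveCartier S.affineCover
      fun k => (flat_and_lfp_blowupStrictTransformMap_chart f 𝓚 hrank hb (S.affineCover.f k)).1,
    blowupStrictTransformMap_of_openCover_base f b _ @LocallyOfFinitePresentation
      hb.isEffectiveCartier S.affineCover
      fun k => (flat_and_lfp_blowupStrictTransformMap_chart f 𝓚 hrank hb (S.affineCover.f k)).2⟩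

end Main

end Literature.AlgebraicGeometry.Resolution

end
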